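import Summits.AtomisticToContinuum.HydrodynamicLimit.Theses.AntiMazurCoboundaries
import Literature.MathematicalPhysics.KineticTheory.HardSphereEulerDim
import Literature.MathematicalPhysics.KineticTheory.HardSphereEulerProofs
import Literature.MathematicalPhysics.KineticTheory.HardSphereEulerLLN
import Literature.Analysis.FluidPDE.HardSphereAlexander
import Literature.Analysis.FunctionSpaces.FlatTorus
import Literature.Analysis.FunctionSpaces.TorusSpaceTime
import Summits.AtomisticToContinuum.HydrodynamicLimit.Theorems.PolynomialCompression.Negative.PdeForm
import Summits.AtomisticToContinuum.HydrodynamicLimit.Theorems.PolynomialCompression.Negative.Statics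
import Summits.AtomisticToContinuum.HydrodynamicLimit.Theorems.DenseExcursion.Negative.Untied

/-!
# `KineticWindowGronwall`: the consequent's `t = 0` tie and Euler balance laws are load-bearing

Negative knowledge for the crux `AntiMazurCoboundaries.KineticWindowGronwall` (stmt-AtomisticToContinuum-9282, the
bare implication `KineticFluxLdDecay → RelEntropyVanishing`, shared with route FluxGibbsianityLdDrude), from the
standing disprover's `Cruxes/KineticWindowGronwall/Disproof.lean` §2–§3:

* `RelEntropyVanishingUntied` — the consequent with its `t = 0` law-of-large-numbers tie DELETED — is FALSE
  (`relEntropyVanishingUntied_false`): the constant state `(2, 0, 1)` is a classical hard-sphere-Euler solution for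
  every `σ` (all derivatives vanish, whatever the equation of state) and has mass `2`, while the empirical density of
  `χ ≡ 1` is identically `1`, so no activity profile gives the exponential concentration clause.
* `RelEntropyVanishingNoPDE` — the consequent with `IsHardSphereEulerSolution` WEAKENED to joint smoothness and
  positivity (the three balance laws deleted, the tie kept) — is FALSE (`relEntropyVanishingNoPDE_false`): for the
  uniform activity the pinned LLN density is `rhoLim ≡ 1` (tree: `localGibbs_lln_holds` via
  `PolynomialCompressionPDE.lln_rhoLim`, `PolynomialCompressionStatics.integral_rhoLim_eq_one`), the smooth positive
  fields `(1 + t, 0, 1)` are tied at `t = 0` and have mass `3/2` at `t = 1/2`.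

Hence, GIVEN the antecedent, the crux with either feature removed from its consequent is false
(`crux_untied_false_of_antecedent`, `crux_noPDE_false_of_antecedent`): any proof of 9282 is anchored in the pinned
initial data and integrates (at least) the continuity equation along the reference solution. Flows by Alexander's
theorem (`HardSphereFlow.nonempty_torus_holds`). refuter-cdisprove-stmt-AtomisticToContinuum-9282-0.
-/

noncomputable section

namespace Summit.AtomisticToContinuum.HydrodynamicLimit.Theorems.KineticWindowGronwallNegative

open MeasureTheory Filter Set Topology
open scoped ENNReal
open Literature.MathematicalPhysics.KineticTheory Literature.Analysis.FluidPDE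
open Literature.Analysis.FunctionSpaces
open Summit.AtomisticToContinuum.HydrodynamicLimit.Theses.AntiMazurCoboundaries
open Summit.AtomisticToContinuum.HydrodynamicLimit.Theorems.PolynomialCompressionPDE (Flows flows_nonempty)
open Summit.AtomisticToContinuum.HydrodynamicLimit.Theorems.DenseExcursionUntied (isHardSphereEulerSolution_const)

/-- `RelEntropyVanishing` with the `t = 0` law-of-large-numbers TIE
`TendstoHydroFieldsAt (fun N => localGibbsLaw σ a₀ u₀ θ₀ N (Φ N)) Φ ρ u θ 0 →` DELETED (all else verbatim):
the Euler solution is then untied from the local Gibbs data. -/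
def RelEntropyVanishingUntied : Prop :=
  ∀ (a₀ θ₀ : T3 → ℝ) (u₀ : T3 → V3), Continuous a₀ → Continuous θ₀ → Continuous u₀ → (∀ x, 0 < a₀ x) →
    (∀ x, 0 < θ₀ x) → ∃ σ₀ : ℝ, 0 < σ₀ ∧ ∀ σ : ℝ, 0 < σ → σ < σ₀ →
    ∀ (T : ℝ) (ρ θ : ℝ → T3 → ℝ) (u : ℝ → T3 → V3), IsHardSphereEulerSolution σ T ρ u θ →
    ∀ Φ : (N : ℕ) → HardSphereFlow (Torus.geometry (Fin 3)) (hsDiameter σ N) (N + 1),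
      (∀ N, IsProbabilityMeasure (localGibbsLaw σ a₀ u₀ θ₀ N (Φ N))) ∧
      (∀ t ∈ Set.Ico 0 T, ∃ a : T3 → ℝ,
        (∀ N, IsProbabilityMeasure (localGibbsLaw σ a (u t) (θ t) N (Φ N))) ∧
        (∀ χ : T3 → ℝ, Continuous χ → ∀ δ : ℝ, 0 < δ → ∃ C : ℝ, 0 < C ∧ ∀ N : ℕ,
          localGibbsLaw σ a (u t) (θ t) N (Φ N)
              {z | δ < |empiricalDensityField z χ - ∫ x, χ x * ρ t x|} ≤
            ENNReal.ofReal (C * Real.exp (-(C⁻¹ * (N + 1)))) ∧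
          localGibbsLaw σ a (u t) (θ t) N (Φ N)
              {z | δ < ‖empiricalMomentumField z χ - ∫ x, (χ x * ρ t x) • u t x‖} ≤
            ENNReal.ofReal (C * Real.exp (-(C⁻¹ * (N + 1)))) ∧
          localGibbsLaw σ a (u t) (θ t) N (Φ N)
              {z | δ < |empiricalEnergyField z χ -
                ∫ x, χ x * totalEnergyDensity (ρ t x) (u t x) (θ t x)|} ≤
            ENNReal.ofReal (C * Real.exp (-(C⁻¹ * (N + 1))))) ∧
        Tendsto (fun N : ℕ => InformationTheory.klDiv
            ((Φ N).lawAt (localGibbsLaw σ a₀ u₀ θ₀ N (Φ N)) t) (localGibbsLaw σ a (u t) (θ t) N (Φ N)) /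
          ((N : ℝ≥0∞) + 1)) atTop (nhds 0))

/-- `C · exp(-(N+1)/C) < 1` for some `N` (the exponential concentration bound eventually beats a
probability-one event). [folklore] -/
theorem exists_conc_bound_lt_one {C : ℝ} (hC : 0 < C) : ∃ N : ℕ, C * Real.exp (-(C⁻¹ * (N + 1))) < 1 := by
  have h1 : Tendsto (fun N : ℕ => C⁻¹ * ((N : ℝ) + 1)) atTop atTop :=
    (tendsto_atTop_add_const_right _ 1 tendsto_natCast_atTop_atTop).const_mul_atTop (inv_pos.2 hC)
  have h2 : Tendsto (fun N : ℕ => C * Real.exp (-(C⁻¹ * ((N : ℝ) + 1)))) atTop (nhds (C * 0)) :=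
    (Real.tendsto_exp_atBot.comp (tendsto_neg_atTop_atBot.comp h1)).const_mul C
  rw [mul_zero] at h2
  exact (h2.eventually (gt_mem_nhds one_pos)).exists

/-- The deviation event of the empirical density of `χ ≡ 1` from a field of mass `m ≠ 1` is EVERYTHING once
`δ < |1 - m|` (the empirical density of `1` is identically `1`). [folklore] -/
theorem devSet_one_eq_univ {N : ℕ} {r : T3 → ℝ} {δ : ℝ} (hδ : δ < |1 - ∫ x, r x|) :
    {z : Config (N + 1) (Fin 3) T3 | δ < |empiricalDensityField z (fun _ => 1) - ∫ x, (fun _ => (1 : ℝ)) x * r x|}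
      = univ := by
  ext z
  simp only [mem_setOf_eq, mem_univ, iff_true, empiricalDensityField_one (Nat.succ_ne_zero N), one_mul]
  exact hδ

/-- **The tie is load-bearing: `RelEntropyVanishingUntied` is FALSE.** Witness: profiles `(1, 0, 1)`; for the
offered `σ₀` take `σ = min(σ₀/2, 1/4)`; the constant classical solution `(2, 0, 1)` on `[0, 1)`; any flow family
(Alexander). At `t = 0` the concentration clause with `χ ≡ 1`, `δ = 1/2` bounds the measure of the WHOLE space
(`|1 - 2| = 1 > 1/2`) by `C e^{-(N+1)/C} < 1` for large `N`, against total mass `1` of the reference law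
(its own clause (i)). [folklore] -/
theorem relEntropyVanishingUntied_false : ¬ RelEntropyVanishingUntied := by
  intro h
  obtain ⟨σ₀, hσ₀, H⟩ := h (fun _ => 1) (fun _ => 1) (fun _ => 0) continuous_const continuous_const
    continuous_const (fun _ => one_pos) (fun _ => one_pos)
  set σ : ℝ := min (σ₀ / 2) (1 / 4) with hσdef
  have hσ : 0 < σ := lt_min (by positivity) (by norm_num)
  have hσlt : σ < σ₀ := (min_le_left _ _).trans_lt (by linarith)
  have hσ2 : σ < 1 / 2 := (min_le_right _ _).trans_lt (by norm_num)
  obtain ⟨Φ⟩ := flows_nonempty hσ hσ2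
  have hE := isHardSphereEulerSolution_const σ 1 (0 : V3) (by norm_num : (0 : ℝ) < 2) one_pos
  obtain ⟨-, H2⟩ := H σ hσ hσlt 1 (fun _ _ => 2) (fun _ _ => 1) (fun _ _ => 0) hE Φ
  obtain ⟨a, hPa, hconc, -⟩ := H2 0 ⟨le_rfl, one_pos⟩
  obtain ⟨C, hC, hN⟩ := hconc (fun _ => 1) continuous_const (1 / 2) (by norm_num)
  obtain ⟨N, hNlt⟩ := exists_conc_bound_lt_one hC
  have hmass : ∫ x : T3, (2 : ℝ) = 2 := by simp
  have hδ : (1 / 2 : ℝ) < |1 - ∫ x : T3, (2 : ℝ)| := by rw [hmass]; norm_num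
  have h1 := (hN N).1
  rw [devSet_one_eq_univ hδ, measure_univ] at h1
  have : (1 : ℝ≥0∞) < 1 :=
    h1.trans_lt (by
      rw [← ENNReal.ofReal_one]
      exact (ENNReal.ofReal_lt_ofReal_iff one_pos).2 (by exact_mod_cast hNlt))
  exact lt_irrefl _ this

/-- Hence NO proof of the crux survives deletion of the tie: given the antecedent, the untied implication
is false. [folklore] -/
theorem crux_untied_false_of_antecedent (hA : KineticFluxLdDecay) :
    ¬ (KineticFluxLdDecay → RelEntropyVanishingUntied) :=
  fun h => relEntropyVanishingUntied_false (h hA)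


/-- The generic contradiction behind §2–§3: under probability laws, an exponential concentration bound for the
empirical density of `χ ≡ 1` around a field `r` of mass `≠ 1` is impossible (the deviation event is everything
once `δ < |1 - ∫ r|`). [folklore] -/
theorem false_of_expConc_mass_ne {σ : ℝ} {a ϑ r : T3 → ℝ} {v : T3 → V3} (Φ : Flows σ)
    (hPa : ∀ N, IsProbabilityMeasure (localGibbsLaw σ a v ϑ N (Φ N))) {δ C : ℝ}
    (hδ : δ < |1 - ∫ x, r x|) (hC : 0 < C)
    (hN : ∀ N : ℕ, localGibbsLaw σ a v ϑ N (Φ N)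
      {z | δ < |empiricalDensityField z (fun _ => 1) - ∫ x, (fun _ => (1 : ℝ)) x * r x|} ≤
        ENNReal.ofReal (C * Real.exp (-(C⁻¹ * (N + 1))))) : False := by
  obtain ⟨N, hNlt⟩ := exists_conc_bound_lt_one hC
  have h1 := hN N
  rw [devSet_one_eq_univ hδ, measure_univ] at h1
  have : (1 : ℝ≥0∞) < 1 :=
    h1.trans_lt (by
      rw [← ENNReal.ofReal_one]
      exact (ENNReal.ofReal_lt_ofReal_iff one_pos).2 (by exact_mod_cast hNlt))
  exact lt_irrefl _ this

/-! ## §3 The Euler balance laws of the consequent are load-bearing -/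

/-- `RelEntropyVanishing` with `IsHardSphereEulerSolution σ T ρ u θ` WEAKENED to its regularity-and-positivity
part (joint smoothness of `ρ, u, θ` on `[0,T) × 𝕋³`, `ρ, θ > 0`; the three balance laws deleted; all else —
including the `t = 0` tie — verbatim). -/
def RelEntropyVanishingNoPDE : Prop :=
  ∀ (a₀ θ₀ : T3 → ℝ) (u₀ : T3 → V3), Continuous a₀ → Continuous θ₀ → Continuous u₀ → (∀ x, 0 < a₀ x) →
    (∀ x, 0 < θ₀ x) → ∃ σ₀ : ℝ, 0 < σ₀ ∧ ∀ σ : ℝ, 0 < σ → σ < σ₀ →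
    ∀ (T : ℝ) (ρ θ : ℝ → T3 → ℝ) (u : ℝ → T3 → V3),
      Torus.IsSmoothSpaceTimeOn (Set.Ico 0 T) ρ → Torus.IsSmoothSpaceTimeOn (Set.Ico 0 T) u →
      Torus.IsSmoothSpaceTimeOn (Set.Ico 0 T) θ → (∀ t ∈ Set.Ico 0 T, ∀ x, 0 < ρ t x) →
      (∀ t ∈ Set.Ico 0 T, ∀ x, 0 < θ t x) →
    ∀ Φ : (N : ℕ) → HardSphereFlow (Torus.geometry (Fin 3)) (hsDiameter σ N) (N + 1),
      (∀ N, IsProbabilityMeasure (localGibbsLaw σ a₀ u₀ θ₀ N (Φ N))) ∧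
      (TendstoHydroFieldsAt (fun N => localGibbsLaw σ a₀ u₀ θ₀ N (Φ N)) Φ ρ u θ 0 →
       ∀ t ∈ Set.Ico 0 T, ∃ a : T3 → ℝ,
        (∀ N, IsProbabilityMeasure (localGibbsLaw σ a (u t) (θ t) N (Φ N))) ∧
        (∀ χ : T3 → ℝ, Continuous χ → ∀ δ : ℝ, 0 < δ → ∃ C : ℝ, 0 < C ∧ ∀ N : ℕ,
          localGibbsLaw σ a (u t) (θ t) N (Φ N)
              {z | δ < |empiricalDensityField z χ - ∫ x, χ x * ρ t x|} ≤
            ENNReal.ofReal (C * Real.exp (-(C⁻¹ * (N + 1)))) ∧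
          localGibbsLaw σ a (u t) (θ t) N (Φ N)
              {z | δ < ‖empiricalMomentumField z χ - ∫ x, (χ x * ρ t x) • u t x‖} ≤
            ENNReal.ofReal (C * Real.exp (-(C⁻¹ * (N + 1)))) ∧
          localGibbsLaw σ a (u t) (θ t) N (Φ N)
              {z | δ < |empiricalEnergyField z χ -
                ∫ x, χ x * totalEnergyDensity (ρ t x) (u t x) (θ t x)|} ≤
            ENNReal.ofReal (C * Real.exp (-(C⁻¹ * (N + 1))))) ∧
        Tendsto (fun N : ℕ => InformationTheory.klDiv
            ((Φ N).lawAt (localGibbsLaw σ a₀ u₀ θ₀ N (Φ N)) t) (localGibbsLaw σ a (u t) (θ t) N (Φ N)) /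
          ((N : ℝ≥0∞) + 1)) atTop (nhds 0))

/-- `TendstoHydroFieldsAt … t` only sees the time-`t` slices of the fields. [folklore] -/
theorem tendstoHydroFieldsAt_congr_slices {ε : ℕ → ℝ} {P : (N : ℕ) → Measure (Config (N + 1) (Fin 3) T3)}
    {Φ : (N : ℕ) → HardSphereFlow (Torus.geometry (Fin 3)) (ε N) (N + 1)}
    {ρ ρ' θ θ' : ℝ → T3 → ℝ} {u u' : ℝ → T3 → V3} {t : ℝ}
    (h1 : ρ t = ρ' t) (h2 : u t = u' t) (h3 : θ t = θ' t) :
    TendstoHydroFieldsAt P Φ ρ u θ t ↔ TendstoHydroFieldsAt P Φ ρ' u' θ' t := by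
  unfold TendstoHydroFieldsAt
  rw [h1, h2, h3]

/-- The non-conservative smooth test density `ρ(t, x) = 1 + t` (mass `1 + t`). -/
def ramp : ℝ → T3 → ℝ := fun t _ => 1 + t

/-- The ramp starts at the uniform density `1`. [folklore] -/
theorem ramp_zero : ramp 0 = fun _ => 1 := funext fun _ => by simp [ramp]

/-- The ramp is jointly smooth (its space–time lift is `(t, y) ↦ 1 + t`). [folklore] -/
theorem isSmoothSpaceTimeOn_ramp (S : Set ℝ) : Torus.IsSmoothSpaceTimeOn S ramp :=
  Torus.isSmoothSpaceTimeOn_of_contDiff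
    (show ContDiff ℝ _ (fun p : ℝ × EuclideanSpace ℝ (Fin 3) => 1 + p.1) from
      contDiff_const.add contDiff_fst) S

/-- For the UNIFORM activity the pinned LLN density `rhoLim (profileOf 1) σ` is the constant `1` (it is constant
in `x` since `β ≡ 1`, and has unit mass under `SmallDensity`). [folklore] -/
theorem rhoLim_uniform_eq_one {σ : ℝ}
    (h : SmallDensity (profileOf (fun _ : T3 => (1 : ℝ)) continuous_const (fun _ => one_pos)) σ) :
    rhoLim (profileOf (fun _ : T3 => (1 : ℝ)) continuous_const (fun _ => one_pos)) σ = fun _ => 1 := by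
  set P := profileOf (fun _ : T3 => (1 : ℝ)) continuous_const (fun _ => one_pos) with hP
  have hconst : ∀ x y : T3, rhoLim P σ x = rhoLim P σ y := fun x y => by
    simp only [hP, rhoLim, profileOf_β]
  funext x
  have h1 := Summit.AtomisticToContinuum.HydrodynamicLimit.Theorems.PolynomialCompressionStatics.integral_rhoLim_eq_one h
  have h2 : ∫ y, rhoLim P σ y = ∫ _ : T3, rhoLim P σ x := integral_congr_ae (Eventually.of_forall fun y => hconst y x)
  rw [h2] at h1
  simpa using h1

/-- **The balance laws are load-bearing: `RelEntropyVanishingNoPDE` is FALSE.** Witness: profiles `(1, 0, 1)`;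
`σ` below the offered `σ₀` and below the tree's LLN threshold `σ₁` (`PolynomialCompressionPDE.lln_rhoLim`, built on
the PROVED `localGibbs_lln_holds`; pinned density `rhoLim ≡ 1` for the uniform activity); the smooth positive fields
`(1 + t, 0, 1)` on `[0, 1)` ARE tied at `t = 0` but have mass `3/2` at `t = 1/2`, so no activity `a` gives the
exponential concentration of the empirical density of `χ ≡ 1` (identically `1`). [folklore] -/
theorem relEntropyVanishingNoPDE_false : ¬ RelEntropyVanishingNoPDE := by
  intro h
  obtain ⟨σ₀, hσ₀, H⟩ := h (fun _ => 1) (fun _ => 1) (fun _ => 0) continuous_const continuous_const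
    continuous_const (fun _ => one_pos) (fun _ => one_pos)
  obtain ⟨σ₁, hσ₁, hσ₁h, L⟩ :=
    Summit.AtomisticToContinuum.HydrodynamicLimit.Theorems.PolynomialCompressionPDE.lln_rhoLim
      (a₀ := fun _ : T3 => (1 : ℝ)) (θ₀ := fun _ => (1 : ℝ)) (u₀ := fun _ => (0 : V3))
      continuous_const continuous_const continuous_const (fun _ => one_pos) (fun _ => one_pos)
  set σ : ℝ := min (σ₀ / 2) (σ₁ / 2) with hσdef
  have hσ : 0 < σ := lt_min (by positivity) (by positivity)
  have hσlt : σ < σ₀ := (min_le_left _ _).trans_lt (by linarith)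
  have hσlt1 : σ < σ₁ := (min_le_right _ _).trans_lt (by linarith)
  have hσ2 : σ < 1 / 2 := hσlt1.trans_le hσ₁h
  obtain ⟨Φ⟩ := flows_nonempty hσ hσ2
  obtain ⟨hsd, -, hL⟩ := L σ hσ hσlt1
  obtain ⟨-, htie⟩ := hL Φ
  have hpos1 : ∀ t ∈ Set.Ico (0 : ℝ) 1, ∀ x : T3, 0 < ramp t x := fun t ht x => by
    simp only [ramp]; linarith [ht.1]
  have hpos2 : ∀ t ∈ Set.Ico (0 : ℝ) 1, ∀ _x : T3, (0 : ℝ) < 1 := fun _ _ _ => one_pos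
  obtain ⟨-, H2⟩ := H σ hσ hσlt 1 ramp (fun _ _ => 1) (fun _ _ => 0) (isSmoothSpaceTimeOn_ramp _)
    (Torus.isSmoothSpaceTimeOn_of_contDiff contDiff_const _)
    (Torus.isSmoothSpaceTimeOn_of_contDiff contDiff_const _) hpos1 hpos2 Φ
  have htie' : TendstoHydroFieldsAt (fun N => localGibbsLaw σ (fun _ => 1) (fun _ => 0) (fun _ => 1) N (Φ N)) Φ
      ramp (fun _ _ => 0) (fun _ _ => 1) 0 := by
    refine (tendstoHydroFieldsAt_congr_slices (ρ' := fun _ => rhoLim (profileOf (fun _ : T3 => (1 : ℝ))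
      continuous_const (fun _ => one_pos)) σ) (u' := fun _ _ => 0) (θ' := fun _ _ => 1) ?_ rfl rfl).2 htie
    rw [ramp_zero, rhoLim_uniform_eq_one hsd]
  obtain ⟨a, hPa, hconc, -⟩ := H2 htie' (1 / 2) ⟨by norm_num, by norm_num⟩
  obtain ⟨C, hC, hN⟩ := hconc (fun _ => 1) continuous_const (1 / 4) (by norm_num)
  have hmass : ∫ x : T3, ramp (1 / 2) x = 3 / 2 := by simp [ramp]; norm_num
  have hδ : (1 / 4 : ℝ) < |1 - ∫ x : T3, ramp (1 / 2) x| := by rw [hmass]; norm_num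
  exact false_of_expConc_mass_ne Φ hPa hδ hC fun N => (hN N).1

/-- Hence, given the antecedent, the crux with the balance laws deleted from its consequent is false: a proof
must integrate the Euler equations (at least mass conservation) along the reference solution. [folklore] -/
theorem crux_noPDE_false_of_antecedent (hA : KineticFluxLdDecay) :
    ¬ (KineticFluxLdDecay → RelEntropyVanishingNoPDE) :=
  fun h => relEntropyVanishingNoPDE_false (h hA)


end Summit.AtomisticToContinuum.HydrodynamicLimit.Theorems.KineticWindowGronwallNegative

end
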